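import Summits.AtomisticToContinuum.HydrodynamicLimit.Theses.BGEndpointRigidity
import Summits.AtomisticToContinuum.HydrodynamicLimit.Theorems.HydroLimitInBand.Negative.LoadBearing
import Summits.AtomisticToContinuum.HydrodynamicLimit.Theorems.HydroLimitInBand.Negative.LoadBearingII
import Summits.AtomisticToContinuum.HydrodynamicLimit.Theorems.HydroLimitInBand.Negative.SigmaZero
import Summits.AtomisticToContinuum.HydrodynamicLimit.Theorems.TwoClocksEntropyToHydro
import HarnessLib

/-!
# `RelEntropyVanishingInBand` (crux stmt-AtomisticToContinuum-17396), negative side: LOAD-BEARING HYPOTHESES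

Refuter crux-attack (vetting) of the shared GUARDED Yau target
`Summit.AtomisticToContinuum.HydrodynamicLimit.Theses.BGEndpointRigidity.RelEntropyVanishingInBand`
(`∃ η₀ > 0` outermost; for continuous positive profiles `∃ σ₀`, for `0 < σ < σ₀`, every classical hs-Euler solution
obeying the packing guard `ρ_t(x)σ³ < η₀`, every flow family: the initial local Gibbs laws are probability measures
and, given the `t = 0` law of large numbers, at every `t < T` some activity profile `a_t` gives a reference local
Gibbs law `(a_t, u_t, θ_t)` with exponential concentration of the conserved fields and `KL(law_t ‖ ref)/(N+1) → 0`).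

The statement SURVIVES the cheap attacks (see the item's check note). This file records WHICH HYPOTHESES ANY PROOF
MUST USE, by transporting the landed load-bearing analysis of the packing-guarded conjunct `HydroLimitInBand`
(`Theorems/HydroLimitInBand/Negative/{LoadBearing,LoadBearingII,SigmaZero}.lean`, refuter-cdisprove lineage of
stmt-9133) through the entropy-inequality dock `Theorems.tendstoHydroFieldsAt_of_klDiv` (which uses neither
`0 < σ` nor any field of the Euler solution):

* `RelEntInBandFor P Sol` — the crux shape with the σ-range `0 < σ` replaced by `P σ` and the solution class
  `IsHardSphereEulerSolution` by `Sol`; `relEntropyVanishingInBand_iff` — the crux is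
  `RelEntInBandFor (0 < ·) IsHardSphereEulerSolution` (definitionally).
* `inBandFor_of_relEntInBandFor` / `withZero_of_relEntInBandFor` — the class-parametric docks (`YauBlock` = the conclusion block).
* **`relEntropyVanishingInBand_false_with_sigma_zero`** — with `0 < σ` relaxed to `0 ≤ σ` the crux is FALSE
  (free streaming of the shear equilibrium at diameter `0`): collisions are load-bearing; no proof can be uniform
  down to the ideal gas.
* **`relEntropyVanishingInBand_false_without_mass / _momentum / _energy / _smooth`** — drop ONE field of
  `IsHardSphereEulerSolution` and the crux is FALSE (explicit homogeneous witnesses of the conjunct's analysis).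
* `RelEntInBandWithoutTie`, **`relEntropyVanishingInBand_false_without_tie`** — drop the `t = 0` law of large
  numbers and the crux is FALSE (the constant solution `(1, 0, 2)` against profiles `(1, 0, 1)`).

refuter-rattack-stmt-AtomisticToContinuum-17396-0, 2026-08-17 (supports stmt-AtomisticToContinuum-17396).
-/

noncomputable section

open MeasureTheory Filter Set Topology InformationTheory
open scoped ENNReal

namespace Summit.AtomisticToContinuum.HydrodynamicLimit.Theorems

open Literature.MathematicalPhysics.KineticTheory Literature.Analysis.FluidPDE
open Literature.Analysis.FunctionSpaces
open Summit.AtomisticToContinuum.HydrodynamicLimit.Theses.BGEndpointRigidity (RelEntropyVanishingInBand)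
open PolynomialCompressionPDE (Flows)
open HydroLimitInBandNegative (SolClass InBandFor HydroLimitInBandWithZero SolWithoutMass SolWithoutMomentum
  SolWithoutEnergy SolWithoutSmooth hydroLimitInBand_false_with_sigma_zero hydroLimitInBand_false_without_mass
  hydroLimitInBand_false_without_momentum hydroLimitInBand_false_without_energy
  hydroLimitInBand_false_without_smooth)

namespace RelEntropyVanishingInBandNegative

/-- The Yau-form conclusion block of the crux at `(σ, T, ρ, u, θ)` for profiles `(a₀, u₀, θ₀)` and a flow family
`Φ`: probability of the initial local Gibbs laws, and — given the `t = 0` tie — at each `t < T` a reference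
activity `a_t` with exponential concentration and vanishing specific relative entropy (verbatim the tail of the
route decl; Yau's form, OVY 1993 §1). -/
def YauBlock (σ : ℝ) (a₀ θ₀ : T3 → ℝ) (u₀ : T3 → V3) (T : ℝ) (ρ θ : ℝ → T3 → ℝ) (u : ℝ → T3 → V3)
    (Φ : Flows σ) : Prop :=
  (∀ N, IsProbabilityMeasure (localGibbsLaw σ a₀ u₀ θ₀ N (Φ N))) ∧
  (TendstoHydroFieldsAt (fun N => localGibbsLaw σ a₀ u₀ θ₀ N (Φ N)) Φ ρ u θ 0 →
    ∀ t ∈ Set.Ico 0 T, ∃ a : T3 → ℝ,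
    (∀ N, IsProbabilityMeasure (localGibbsLaw σ a (u t) (θ t) N (Φ N))) ∧
    (∀ χ : T3 → ℝ, Continuous χ → ∀ δ : ℝ, 0 < δ → ∃ C : ℝ, 0 < C ∧ ∀ N : ℕ,
      localGibbsLaw σ a (u t) (θ t) N (Φ N)
          {z | δ < |empiricalDensityField z χ - ∫ x, χ x * ρ t x|} ≤
        ENNReal.ofReal (C * Real.exp (-(C⁻¹ * (N + 1)))) ∧
      localGibbsLaw σ a (u t) (θ t) N (Φ N)
          {z | δ < ‖empiricalMomentumField z χ - ∫ x, (χ x * ρ t x) • u t x‖} ≤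
        ENNReal.ofReal (C * Real.exp (-(C⁻¹ * (N + 1)))) ∧
      localGibbsLaw σ a (u t) (θ t) N (Φ N)
          {z | δ < |empiricalEnergyField z χ -
            ∫ x, χ x * totalEnergyDensity (ρ t x) (u t x) (θ t x)|} ≤
        ENNReal.ofReal (C * Real.exp (-(C⁻¹ * (N + 1))))) ∧
    Tendsto (fun N : ℕ => klDiv ((Φ N).lawAt (localGibbsLaw σ a₀ u₀ θ₀ N (Φ N)) t)
      (localGibbsLaw σ a (u t) (θ t) N (Φ N)) / ((N : ℝ≥0∞) + 1)) atTop (𝓝 0))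

/-- **The crux shape over a σ-range `P` and a solution class `Sol`**: `RelEntropyVanishingInBand` with `0 < σ`
replaced by `P σ` and `IsHardSphereEulerSolution` replaced by `Sol` (everything else verbatim). A statement SHAPE used
only to phrase the negative lemmas below (not a fact). -/
def RelEntInBandFor (P : ℝ → Prop) (Sol : SolClass) : Prop :=
  ∃ η₀ : ℝ, 0 < η₀ ∧ ∀ (a₀ θ₀ : T3 → ℝ) (u₀ : T3 → V3), Continuous a₀ → Continuous θ₀ → Continuous u₀ →
    (∀ x, 0 < a₀ x) → (∀ x, 0 < θ₀ x) → ∃ σ₀ : ℝ, 0 < σ₀ ∧ ∀ σ : ℝ, P σ → σ < σ₀ →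
    ∀ (T : ℝ) (ρ θ : ℝ → T3 → ℝ) (u : ℝ → T3 → V3), Sol σ T ρ u θ →
    (∀ t ∈ Ico 0 T, ∀ x, ρ t x * σ ^ 3 < η₀) →
    ∀ Φ : Flows σ, YauBlock σ a₀ θ₀ u₀ T ρ θ u Φ

/-- The crux is `RelEntInBandFor (0 < ·) IsHardSphereEulerSolution` (definitionally). [folklore] -/
theorem relEntropyVanishingInBand_iff :
    RelEntropyVanishingInBand ↔ RelEntInBandFor (fun σ => 0 < σ) IsHardSphereEulerSolution :=
  Iff.rfl

/-- **The Yau block docks onto the LLN transfer** at one `(σ, T, ρ, u, θ, Φ)`: the entropy inequality for events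
(`tendstoHydroFieldsAt_of_klDiv`) uses neither the sign of `σ` nor the Euler equations. [cite: Yau1991, §2] -/
theorem transfer_of_yauBlock {σ : ℝ} {a₀ θ₀ : T3 → ℝ} {u₀ : T3 → V3} {T : ℝ} {ρ θ : ℝ → T3 → ℝ}
    {u : ℝ → T3 → V3} {Φ : Flows σ} (h : YauBlock σ a₀ θ₀ u₀ T ρ θ u Φ)
    (h0 : TendstoHydroFieldsAt (fun N => localGibbsLaw σ a₀ u₀ θ₀ N (Φ N)) Φ ρ u θ 0) :
    ∀ t ∈ Ico 0 T, TendstoHydroFieldsAt (fun N => localGibbsLaw σ a₀ u₀ θ₀ N (Φ N)) Φ ρ u θ t := by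
  intro t ht
  obtain ⟨hprob, hmain⟩ := h
  obtain ⟨a, hψ, hconc, hkl⟩ := hmain h0 t ht
  exact tendstoHydroFieldsAt_of_klDiv (a := a) Φ hconc hkl

/-- **Class-parametric dock**: for every solution class, the Yau form implies the LLN-transfer form
(`HydroLimitInBandNegative.InBandFor`) with the same `η₀`, `σ₀`. [cite: Yau1991, §2] -/
theorem inBandFor_of_relEntInBandFor (Sol : SolClass) (h : RelEntInBandFor (fun σ => 0 < σ) Sol) :
    InBandFor Sol := by
  obtain ⟨η₀, hη₀, H⟩ := h
  refine ⟨η₀, hη₀, fun a₀ θ₀ u₀ ha hθ hu ha0 hθ0 => ?_⟩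
  obtain ⟨σ₀, hσ₀, G⟩ := H a₀ θ₀ u₀ ha hθ hu ha0 hθ0
  exact ⟨σ₀, hσ₀, fun σ hσ hσ' T ρ θ u hE hg Φ h0 t ht =>
    transfer_of_yauBlock (G σ hσ hσ' T ρ θ u hE hg Φ) h0 t ht⟩

/-- **Dock at `0 ≤ σ`**: the Yau form with `0 < σ` relaxed to `0 ≤ σ` implies the conjunct's relaxed form
`HydroLimitInBandNegative.HydroLimitInBandWithZero`. [cite: Yau1991, §2] -/
theorem withZero_of_relEntInBandFor (h : RelEntInBandFor (fun σ => 0 ≤ σ) IsHardSphereEulerSolution) :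
    HydroLimitInBandWithZero := by
  obtain ⟨η₀, hη₀, H⟩ := h
  refine ⟨η₀, hη₀, fun a₀ θ₀ u₀ ha hθ hu ha0 hθ0 => ?_⟩
  obtain ⟨σ₀, hσ₀, G⟩ := H a₀ θ₀ u₀ ha hθ hu ha0 hθ0
  exact ⟨σ₀, hσ₀, fun σ hσ hσ' T ρ θ u hE hg Φ h0 t ht =>
    transfer_of_yauBlock (G σ hσ hσ' T ρ θ u hE hg Φ) h0 t ht⟩

/-! ## Tightness of `0 < σ` -/

/-- **`0 < σ` IS LOAD-BEARING — the crux with `0 ≤ σ` is FALSE.** At `σ = 0` (diameter `hsDiameter 0 N = 0`, free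
flight, product local Gibbs laws) the stationary shear `(1, sin(2π x₁) e₀, 1)` is an admissible guarded classical
solution whose momentum field free-streams to the Knudsen value `e^{-2π²}/2 ≠ 1/2` at `t = 1`
(`HydroLimitInBandNegative.hydroLimitInBand_false_with_sigma_zero`); the Yau form would imply the LLN transfer there.
Hence collisions must enter any proof of the crux quantitatively; no estimate can be uniform as `σ ↓ 0`. [folklore] -/
theorem relEntropyVanishingInBand_false_with_sigma_zero :
    ¬ RelEntInBandFor (fun σ => 0 ≤ σ) IsHardSphereEulerSolution :=
  fun h => hydroLimitInBand_false_with_sigma_zero (withZero_of_relEntInBandFor h)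

/-- The relaxed σ-range only strengthens the statement: `RelEntInBandFor (0 ≤ ·) Sol → RelEntInBandFor (0 < ·) Sol`
(so the negation above is the strongest form of the tightness claim). [folklore] -/
theorem relEntInBandFor_pos_of_nonneg (Sol : SolClass) (h : RelEntInBandFor (fun σ => 0 ≤ σ) Sol) :
    RelEntInBandFor (fun σ => 0 < σ) Sol := by
  obtain ⟨η₀, hη₀, H⟩ := h
  refine ⟨η₀, hη₀, fun a₀ θ₀ u₀ ha hθ hu ha0 hθ0 => ?_⟩
  obtain ⟨σ₀, hσ₀, G⟩ := H a₀ θ₀ u₀ ha hθ hu ha0 hθ0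
  exact ⟨σ₀, hσ₀, fun σ hσ hσ' => G σ hσ.le hσ'⟩

/-! ## The Euler equations are load-bearing, field by field -/

/-- **Without the MASS equation the crux is FALSE** (homogeneous witness `ρ = 1 + t`, `θ = 1/(1+t)` of the
conjunct's analysis, transported through the dock). [folklore] -/
theorem relEntropyVanishingInBand_false_without_mass : ¬ RelEntInBandFor (fun σ => 0 < σ) SolWithoutMass :=
  fun h => hydroLimitInBand_false_without_mass (inBandFor_of_relEntInBandFor _ h)

/-- **Without the MOMENTUM equation the crux is FALSE** (witness `u = t e₀`, `θ = 1 − t²/3`). [folklore] -/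
theorem relEntropyVanishingInBand_false_without_momentum :
    ¬ RelEntInBandFor (fun σ => 0 < σ) SolWithoutMomentum :=
  fun h => hydroLimitInBand_false_without_momentum (inBandFor_of_relEntInBandFor _ h)

/-- **Without the ENERGY equation the crux is FALSE** (witness `θ = 1 + t`). [folklore] -/
theorem relEntropyVanishingInBand_false_without_energy :
    ¬ RelEntInBandFor (fun σ => 0 < σ) SolWithoutEnergy :=
  fun h => hydroLimitInBand_false_without_energy (inBandFor_of_relEntInBandFor _ h)

/-- **Without joint SMOOTHNESS the crux is FALSE** (a density jumping at `t = 0⁺` whose junk one-sided derivative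
vanishes satisfies the pointwise equations). [folklore] -/
theorem relEntropyVanishingInBand_false_without_smooth :
    ¬ RelEntInBandFor (fun σ => 0 < σ) SolWithoutSmooth :=
  fun h => hydroLimitInBand_false_without_smooth (inBandFor_of_relEntInBandFor _ h)

/-! ## The `t = 0` law of large numbers (the tie) is load-bearing -/

/-- The crux with the `t = 0` law-of-large-numbers hypothesis dropped (the Yau block asserted outright at every
`t < T`). A statement variant used only to phrase the negative lemma below (not a fact; it is FALSE). -/
def RelEntInBandWithoutTie : Prop :=
  ∃ η₀ : ℝ, 0 < η₀ ∧ ∀ (a₀ θ₀ : T3 → ℝ) (u₀ : T3 → V3), Continuous a₀ → Continuous θ₀ → Continuous u₀ →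
    (∀ x, 0 < a₀ x) → (∀ x, 0 < θ₀ x) → ∃ σ₀ : ℝ, 0 < σ₀ ∧ ∀ σ : ℝ, 0 < σ → σ < σ₀ →
    ∀ (T : ℝ) (ρ θ : ℝ → T3 → ℝ) (u : ℝ → T3 → V3), IsHardSphereEulerSolution σ T ρ u θ →
    (∀ t ∈ Ico 0 T, ∀ x, ρ t x * σ ^ 3 < η₀) →
    ∀ Φ : Flows σ, (∀ N, IsProbabilityMeasure (localGibbsLaw σ a₀ u₀ θ₀ N (Φ N))) ∧
    ∀ t ∈ Set.Ico 0 T, ∃ a : T3 → ℝ,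
    (∀ N, IsProbabilityMeasure (localGibbsLaw σ a (u t) (θ t) N (Φ N))) ∧
    (∀ χ : T3 → ℝ, Continuous χ → ∀ δ : ℝ, 0 < δ → ∃ C : ℝ, 0 < C ∧ ∀ N : ℕ,
      localGibbsLaw σ a (u t) (θ t) N (Φ N)
          {z | δ < |empiricalDensityField z χ - ∫ x, χ x * ρ t x|} ≤
        ENNReal.ofReal (C * Real.exp (-(C⁻¹ * (N + 1)))) ∧
      localGibbsLaw σ a (u t) (θ t) N (Φ N)
          {z | δ < ‖empiricalMomentumField z χ - ∫ x, (χ x * ρ t x) • u t x‖} ≤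
        ENNReal.ofReal (C * Real.exp (-(C⁻¹ * (N + 1)))) ∧
      localGibbsLaw σ a (u t) (θ t) N (Φ N)
          {z | δ < |empiricalEnergyField z χ -
            ∫ x, χ x * totalEnergyDensity (ρ t x) (u t x) (θ t x)|} ≤
        ENNReal.ofReal (C * Real.exp (-(C⁻¹ * (N + 1))))) ∧
    Tendsto (fun N : ℕ => klDiv ((Φ N).lawAt (localGibbsLaw σ a₀ u₀ θ₀ N (Φ N)) t)
      (localGibbsLaw σ a (u t) (θ t) N (Φ N)) / ((N : ℝ≥0∞) + 1)) atTop (𝓝 0)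

-- (Dropping the tie only strengthens the statement — `RelEntInBandWithoutTie → RelEntropyVanishingInBand` by
-- `fun _ t ht => hmain t ht` — so the negation below is the strongest form of the load-bearing claim; the positive
-- direction is not stated as a theorem here: a conditional proof of a Theses decl is a prover's landing.)

/-- **The `t = 0` tie IS LOAD-BEARING — without it the crux is FALSE**: at time `t = 0` the law IS the initial local
Gibbs law (`Φ_0 = id` a.e.), so the untied Yau block would make the homogeneous Gibbs law of temperature `1` follow
the constant classical solution `(1, 0, 2)` (kinetic energy `3` per particle instead of `3/2`), against equilibrium
rigidity — transported from `HydroLimitInBandNegative.hydroLimitInBand_false_without_tie` through the dock. [folklore] -/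
theorem relEntropyVanishingInBand_false_without_tie : ¬ RelEntInBandWithoutTie := by
  intro h
  refine HydroLimitInBandNegative.hydroLimitInBand_false_without_tie ?_
  obtain ⟨η₀, hη₀, H⟩ := h
  refine ⟨η₀, hη₀, fun a₀ θ₀ u₀ ha hθ hu ha0 hθ0 => ?_⟩
  obtain ⟨σ₀, hσ₀, G⟩ := H a₀ θ₀ u₀ ha hθ hu ha0 hθ0
  refine ⟨σ₀, hσ₀, fun σ hσ hσ' T ρ θ u hE hg Φ t ht => ?_⟩
  obtain ⟨hprob, hmain⟩ := G σ hσ hσ' T ρ θ u hE hg Φ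
  obtain ⟨a, hψ, hconc, hkl⟩ := hmain t ht
  exact tendstoHydroFieldsAt_of_klDiv (a := a) Φ hconc hkl

end RelEntropyVanishingInBandNegative

end Summit.AtomisticToContinuum.HydrodynamicLimit.Theorems

end
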